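import Mathlib
import HarnessLib
import Literature.RingTheory.CohomologyAnnihilator.Basic
import Literature.RingTheory.CohomologyAnnihilator.SyzygyBasic
import Literature.RingTheory.CohomologyAnnihilator.SyzygyDescent
import Literature.RingTheory.CohomologyAnnihilator.RegularRing
import Summits.ResolutionOfSingularities.ResolutionOfSingularities.Theorems.HomologicalConductorNoZenoStableAnnihilatorReduction
import Summits.ResolutionOfSingularities.ResolutionOfSingularities.Theorems.HomologicalConductorPersistenceHypersurfaceJacobian
import Summits.ResolutionOfSingularities.ResolutionOfSingularities.Theorems.HomologicalConductorPersistenceHypersurfacePeriodicity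

/-!
# Periodic saturation of the cohomology annihilator: `ca(T) = caᵈ⁺¹(T)` when `d`-th syzygies are periodic

Route `ResolutionOfSingularities/HomologicalConductor`, chain W4.4b, rung S-2 `PersistenceSurface`
(stmt-ResolutionOfSingularities-19970), obligation node `SaturationFourSurface` of
`Theorems/HomologicalConductorPersistenceSurfaceLevelFour.lean` ("`ca(T_m) ⊆ ca⁴(T_m)` at every stage;
automatic at regular and Gorenstein stages; OPEN in general").  [OURS · L1 w44b · res-type-011;
AI-written, weaker than expert review; NOT a statement of the manuscript under study, and no statement
of that manuscript is used.]

This Theses-free module is the ABSTRACT half of the "automatic at Gorenstein (periodic) stages" remark,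
in the tree's vocabulary (`IsSyzygy`, `StablyAnnihilates`, the reduction lemma CA1
`mem_cohomologyAnnihilatorOfDegree_succ_iff_forall_isSyzygy` of
`Theorems/HomologicalConductorNoZenoStableAnnihilatorReduction.lean`):

* `IsSyzygy.self_mul` — a `q`-PERIODIC module (`K` is a `q`-th syzygy of itself) is a `q·t`-th syzygy
  of itself for every `t`;
* `exists_isSyzygy_split` — an `(b + a)`-th syzygy of `M` is a `b`-th syzygy of an `a`-th syzygy of `M`;
* `cohomologyAnnihilatorOfDegree_eq_of_isSyzygy_self` — **PERIODIC SATURATION**: over a noetherian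
  ring `T`, if every `d`-th syzygy module `K = Ωᵈ M` of every finitely generated `M` is `q`-periodic
  for some `q ≥ 1` (`IsSyzygy q K K`; e.g. `q = 2` for maximal Cohen–Macaulay modules over a
  hypersurface, Eisenbud's matrix-factorisation periodicity), then `caⁿ(T) = caᵈ⁺¹(T)` for every
  `n ≥ d + 1`, and `cohomologyAnnihilator_eq_of_isSyzygy_self` — `ca(T) = caᵈ⁺¹(T)`.
  Proof: for `x ∈ caᵐ⁺¹(T)` (`m ≥ d`) and `K = Ωᵈ M`, `K = Ω^{q·m} K = Ω^{q·m + d} M` is an `m`-th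
  syzygy of the finitely generated `Ω^{(q-1)·m + d} M`, so `x` stably annihilates `K` (CA1 `⇒`);
  CA1 `⇐` at level `d` gives `x ∈ caᵈ⁺¹(T)`.
* `smul_ext_eq_zero_of_mem_cohomologyAnnihilator_of_isSyzygy_self` — pointwise form: such `x ∈ ca(T)`
  kills `Extⁱ(M, N)` for all `i ≥ d + 1` and all finitely generated `M`, `N`.
* **HYPERSURFACE STAGES** (`§ Saturation`, with the periodicity instance
  `Theorems/HomologicalConductorPersistenceHypersurfacePeriodicity.lean` and the `S`-projectivity of
  `d`-th syzygies from `Theorems/HomologicalConductorPersistenceHypersurfaceJacobian.lean`):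
  `cohomologyAnnihilatorOfDegree_eq_of_powerBasis` / `cohomologyAnnihilator_eq_of_powerBasis` —
  `ca(B) = caᵈ⁺¹(B) = caⁿ(B)` (`n ≥ d + 1`) for `B` with a power basis over a noetherian `S` with
  `caᵈ⁺¹(S) = S`; `cohomologyAnnihilator_adjoinRoot_eq` (`B = S[X]/(f)`, `f` monic),
  `cohomologyAnnihilator_adjoinRoot_eq_of_isRegularRing` (`S` regular of dimension `≤ d`),
  `cohomologyAnnihilator_adjoinRoot_mvPolynomial_eq` (`S = k[x₁,…,x_d]`, any field `k`).
  So `Sat_{d+1}` — a fortiori the chain's `SaturationFourSurface` shape `ca ⊆ ca⁴` on surface towers —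
  holds at every hypersurface stage (all RDP specimens at stage `0`), characteristic-free, with no
  recurrence hypothesis `(Rec)`.

What this is NOT: a statement about non-periodic (e.g. non-Gorenstein rational) stages, where level
`d + 1` can fail (chain memo N10/N11: `(1/3(1,1) × line)_Q`); the Gorenstein (non-hypersurface) case
(no injective-dimension infrastructure is used or built here); the localisation of periodicity to the
local rings `B_Q` of the tower (not needed for the global `ca(B)` statements above).

References (for the periodicity phenomenon only; nothing here is cited as a premise): D. Eisenbud,
*Homological algebra on a complete intersection, with an application to group representations*,
Trans. AMS 260 (1980); S. B. Iyengar, R. Takahashi, IMRN 2016 (arXiv:1404.1476) §2 [`IyengarTakahashi2014`].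
-/

noncomputable section

-- single-problem summit: the doubled namespace component `ResolutionOfSingularities` is forced
set_option linter.dupNamespace false

namespace Summit.ResolutionOfSingularities.ResolutionOfSingularities.Theorems.HomologicalConductor.PeriodicSaturation

open CategoryTheory CategoryTheory.Abelian Literature.RingTheory.CohomologyAnnihilator
open Summit.ResolutionOfSingularities.ResolutionOfSingularities.Theorems.NoZeno.SandwichCluster

universe u

variable {T : Type u} [CommRing T]

/-- A `q`-periodic module (`K` is a `q`-th syzygy of itself) is a `(q·t)`-th syzygy of itself for
every `t` (iterate `IsSyzygy.trans`). [folklore] -/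
theorem IsSyzygy.self_mul {q : ℕ} {K : ModuleCat.{u} T} (h : IsSyzygy q K K) :
    ∀ t : ℕ, IsSyzygy (q * t) K K
  | 0 => ⟨Iso.refl K⟩
  | t + 1 => by
    have ih := IsSyzygy.self_mul h t
    have := h.trans ih
    simpa [Nat.mul_succ] using this

/-- Splitting a syzygy chain: a `(b + a)`-th syzygy `K` of `M` is a `b`-th syzygy of some `a`-th
syzygy `M'` of `M` (peel first syzygies `a` times, `isSyzygy_succ_iff_exists_first`). [folklore] -/
theorem exists_isSyzygy_split :
    ∀ (a : ℕ) {b : ℕ} {M K : ModuleCat.{u} T},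
      IsSyzygy (b + a) M K → ∃ M' : ModuleCat.{u} T, IsSyzygy a M M' ∧ IsSyzygy b M' K
  | 0, _, M, _, h => ⟨M, ⟨Iso.refl M⟩, h⟩
  | a + 1, b, M, K, h => by
    have h' : IsSyzygy ((b + a) + 1) M K := by simpa [Nat.add_assoc] using h
    obtain ⟨M₁, h1, h₁⟩ := isSyzygy_succ_iff_exists_first.mp h'
    obtain ⟨M', ha, hb⟩ := exists_isSyzygy_split a h₁
    exact ⟨M', h1.trans ha, hb⟩

/-- **Periodic saturation, levelled form.** Over a noetherian ring `T`: if every `d`-th syzygy module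
of every finitely generated module is `q`-periodic for some `q ≥ 1` (`IsSyzygy q K K`), then the
cohomology-annihilator tower is constant from level `d + 1` on: `caⁿ(T) = caᵈ⁺¹(T)` for all
`n ≥ d + 1`. [OURS; folklore mechanism (Eisenbud periodicity ⇒ `Ext` periodicity)] -/
theorem cohomologyAnnihilatorOfDegree_eq_of_isSyzygy_self [IsNoetherianRing T] (d : ℕ)
    (hper : ∀ (M K : ModuleCat.{u} T), Module.Finite T M → IsSyzygy d M K →
      ∃ q : ℕ, 0 < q ∧ IsSyzygy q K K)
    {n : ℕ} (hn : d + 1 ≤ n) :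
    cohomologyAnnihilatorOfDegree T n = cohomologyAnnihilatorOfDegree T (d + 1) := by
  refine le_antisymm ?_ (cohomologyAnnihilatorOfDegree_mono hn)
  obtain ⟨m, rfl⟩ : ∃ m, n = m + 1 := ⟨n - 1, by omega⟩
  intro x hx
  rw [mem_cohomologyAnnihilatorOfDegree_succ_iff_forall_isSyzygy]
  intro M K hM hK
  obtain ⟨q, hq, hKK⟩ := hper M K hM hK
  -- `K = Ω^{q m} K = Ω^{q m + d} M`
  have hbig : IsSyzygy (q * m + d) M K := hK.trans (IsSyzygy.self_mul hKK m)
  -- write `q m + d = m + ((q - 1) m + d)` and split off an `m`-th syzygy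
  obtain ⟨q', rfl⟩ : ∃ q', q = q' + 1 := ⟨q - 1, by omega⟩
  have hsplit : IsSyzygy (m + (q' * m + d)) M K := by
    have : (q' + 1) * m + d = m + (q' * m + d) := by ring
    rw [this] at hbig
    exact hbig
  obtain ⟨M', hM', hmK⟩ := exists_isSyzygy_split (q' * m + d) hsplit
  haveI : Module.Finite T M' := finite_of_isSyzygy _ hM hM'
  exact (mem_cohomologyAnnihilatorOfDegree_succ_iff_forall_isSyzygy x).mp hx M' K ‹_› hmK

/-- **Periodic saturation.** Over a noetherian ring `T` whose `d`-th syzygy modules are all periodic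
(`IsSyzygy q K K` for some `q ≥ 1`), the cohomology annihilator is reached at level `d + 1`:
`ca(T) = caᵈ⁺¹(T)`. [OURS; folklore mechanism] -/
theorem cohomologyAnnihilator_eq_of_isSyzygy_self [IsNoetherianRing T] (d : ℕ)
    (hper : ∀ (M K : ModuleCat.{u} T), Module.Finite T M → IsSyzygy d M K →
      ∃ q : ℕ, 0 < q ∧ IsSyzygy q K K) :
    cohomologyAnnihilator T = cohomologyAnnihilatorOfDegree T (d + 1) := by
  refine le_antisymm ?_ (cohomologyAnnihilatorOfDegree_le _)
  intro x hx
  obtain ⟨n, hn⟩ := mem_cohomologyAnnihilator_iff.mp hx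
  have hx' : x ∈ cohomologyAnnihilatorOfDegree T (max n (d + 1)) :=
    cohomologyAnnihilatorOfDegree_mono (le_max_left _ _) hn
  rwa [cohomologyAnnihilatorOfDegree_eq_of_isSyzygy_self d hper (le_max_right _ _)] at hx'

/-- The `2`-periodic case (hypersurface shape): if every `d`-th syzygy module is a second syzygy of
itself then `ca(T) = caᵈ⁺¹(T)`. [OURS] -/
theorem cohomologyAnnihilator_eq_of_isSyzygy_two_self [IsNoetherianRing T] (d : ℕ)
    (hper : ∀ (M K : ModuleCat.{u} T), Module.Finite T M → IsSyzygy d M K → IsSyzygy 2 K K) :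
    cohomologyAnnihilator T = cohomologyAnnihilatorOfDegree T (d + 1) :=
  cohomologyAnnihilator_eq_of_isSyzygy_self d fun M K hM hK => ⟨2, two_pos, hper M K hM hK⟩

/-- Pointwise form of periodic saturation: under the periodicity hypothesis every `x ∈ ca(T)` kills
`Extⁱ(M, N)` for ALL `i ≥ d + 1` and all finitely generated `M`, `N` (no dependence of the level on
`x`). [OURS] -/
theorem smul_ext_eq_zero_of_mem_cohomologyAnnihilator_of_isSyzygy_self [IsNoetherianRing T] (d : ℕ)
    (hper : ∀ (M K : ModuleCat.{u} T), Module.Finite T M → IsSyzygy d M K →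
      ∃ q : ℕ, 0 < q ∧ IsSyzygy q K K)
    {x : T} (hx : x ∈ cohomologyAnnihilator T) {i : ℕ} (hi : d + 1 ≤ i)
    (M N : ModuleCat.{u} T) [Module.Finite T M] [Module.Finite T N] (e : Ext.{u} M N i) :
    x • e = 0 := by
  rw [cohomologyAnnihilator_eq_of_isSyzygy_self d hper] at hx
  exact smul_eq_zero_of_mem_cohomologyAnnihilatorOfDegree hx hi e

/-! ## Saturation at hypersurface stages -/

section Saturation

open Summit.ResolutionOfSingularities.ResolutionOfSingularities.Theorems.HomologicalConductor.HypersurfacePeriodicity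
open Summit.ResolutionOfSingularities.ResolutionOfSingularities.Theorems.HomologicalConductor.PersistenceHypersurfaceJacobian

variable {S : Type u} {B : Type u} [CommRing S] [CommRing B] [Algebra S B]

/-- **Saturation at hypersurface stages, levelled form.** Let `S` be noetherian with `caᵈ⁺¹(S) = S`
(every finitely generated `S`-module has projective dimension `≤ d`; e.g. `S` regular of dimension
`≤ d`) and let `B` carry a power basis over `S` (`B = ⊕_{i<n} S zⁱ`, e.g. `B = S[X]/(f)`, `f` monic).
Then the cohomology-annihilator tower of `B` is constant from level `d + 1` on:
`caⁿ(B) = caᵈ⁺¹(B)` for every `n ≥ d + 1`.  Proof: `d`-th syzygies over `B` are `S`-projective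
(`PersistenceHypersurfaceJacobian.projective_restrictScalars_of_isSyzygy`), hence `2`-periodic
(`HypersurfacePeriodicity.isSyzygy_two_self`), and periodic saturation applies.  (Rank `0`: `B = 0`
and every ideal is `⊤`.) [OURS; mechanism: Eisenbud 1980 periodicity] -/
theorem cohomologyAnnihilatorOfDegree_eq_of_powerBasis [IsNoetherianRing S] (pb : PowerBasis S B)
    {d : ℕ} (hvan : cohomologyAnnihilatorOfDegree S (d + 1) = ⊤) {n : ℕ} (hn : d + 1 ≤ n) :
    cohomologyAnnihilatorOfDegree B n = cohomologyAnnihilatorOfDegree B (d + 1) := by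
  haveI : Module.Finite S B := pb.finite
  haveI : Module.Free S B := Module.Free.of_basis pb.basis
  haveI : IsNoetherianRing B := isNoetherian_of_tower S inferInstance
  by_cases hdim : pb.dim = 0
  · haveI : Subsingleton B := by
      have e := pb.basis.equivFun
      rw [hdim] at e
      exact e.toEquiv.subsingleton
    exact Subsingleton.elim _ _
  refine cohomologyAnnihilatorOfDegree_eq_of_isSyzygy_self d (fun M K hM hK => ⟨2, two_pos, ?_⟩) hn
  haveI := hM
  have hKproj := projective_restrictScalars_of_isSyzygy hvan hK
  letI : Module S K := Module.compHom K (algebraMap S B)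
  haveI : IsScalarTower S B K := IsScalarTower.of_algebraMap_smul fun _ _ => rfl
  haveI : Module.Projective S K :=
    (IsProjective.iff_projective (R := S) ((restrictScalarsFunctor S B).obj K)).mpr hKproj
  haveI : Module.Finite B K := Literature.RingTheory.CohomologyAnnihilator.finite_of_isSyzygy d hM hK
  exact isSyzygy_two_self pb (Nat.pos_of_ne_zero hdim) K

/-- **Saturation at hypersurface stages: `ca(B) = caᵈ⁺¹(B)`** for `B` with a power basis over a
noetherian `S` with `caᵈ⁺¹(S) = S` — in particular `Sat_{d+1}` (a fortiori `Sat₄` on surface towers,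
`d = 2`) holds at every HYPERSURFACE stage `S[X]/(f)` over a regular base, characteristic-free and with
no recurrence hypothesis.  Consistent with the chain's N10/N11: at the non-Gorenstein stage
`(1/3(1,1) × line)_Q` level `d + 1` fails, and periodicity is exactly what fails there. [OURS] -/
theorem cohomologyAnnihilator_eq_of_powerBasis [IsNoetherianRing S] (pb : PowerBasis S B)
    {d : ℕ} (hvan : cohomologyAnnihilatorOfDegree S (d + 1) = ⊤) :
    cohomologyAnnihilator B = cohomologyAnnihilatorOfDegree B (d + 1) := by
  refine le_antisymm ?_ (cohomologyAnnihilatorOfDegree_le _)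
  intro x hx
  obtain ⟨n, hn⟩ := mem_cohomologyAnnihilator_iff.mp hx
  have hx' : x ∈ cohomologyAnnihilatorOfDegree B (max n (d + 1)) :=
    cohomologyAnnihilatorOfDegree_mono (le_max_left _ _) hn
  rwa [cohomologyAnnihilatorOfDegree_eq_of_powerBasis pb hvan (le_max_right _ _)] at hx'

/-- `ca(S[X]/(f)) = caᵈ⁺¹(S[X]/(f))` for `f` monic over a noetherian `S` with `caᵈ⁺¹(S) = S`. [OURS] -/
theorem cohomologyAnnihilator_adjoinRoot_eq [IsNoetherianRing S] {f : Polynomial S} (hf : f.Monic)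
    {d : ℕ} (hvan : cohomologyAnnihilatorOfDegree S (d + 1) = ⊤) :
    cohomologyAnnihilator (AdjoinRoot f) = cohomologyAnnihilatorOfDegree (AdjoinRoot f) (d + 1) :=
  cohomologyAnnihilator_eq_of_powerBasis (AdjoinRoot.powerBasis' hf) hvan

/-- `ca(S[X]/(f)) = caᵈ⁺¹(S[X]/(f))` for `f` monic over a REGULAR ring `S` of Krull dimension `≤ d`
(tree `cohomologyAnnihilatorOfDegree_eq_top_of_isRegularRing`). [OURS] -/
theorem cohomologyAnnihilator_adjoinRoot_eq_of_isRegularRing [IsRegularRing S]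
    {d : ℕ} (hd : ringKrullDim S ≤ d) {f : Polynomial S} (hf : f.Monic) :
    cohomologyAnnihilator (AdjoinRoot f) = cohomologyAnnihilatorOfDegree (AdjoinRoot f) (d + 1) :=
  cohomologyAnnihilator_adjoinRoot_eq hf (cohomologyAnnihilatorOfDegree_eq_top_of_isRegularRing S hd)

/-- `ca(k[x₁,…,x_d][X]/(f)) = caᵈ⁺¹` for `f` monic in `X` over a polynomial ring over any field `k`
(Hilbert syzygies, tree `cohomologyAnnihilatorOfDegree_mvPolynomial_eq_top`): every affine
hypersurface `k[x₁,…,x_d,X]/(f)` with `f` monic in `X`, in every characteristic. [OURS] -/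
theorem cohomologyAnnihilator_adjoinRoot_mvPolynomial_eq (k : Type u) [Field k] (d : ℕ)
    {f : Polynomial (MvPolynomial (Fin d) k)} (hf : f.Monic) :
    cohomologyAnnihilator (AdjoinRoot f) = cohomologyAnnihilatorOfDegree (AdjoinRoot f) (d + 1) :=
  cohomologyAnnihilator_adjoinRoot_eq hf (cohomologyAnnihilatorOfDegree_mvPolynomial_eq_top k d)

end Saturation

/-! ## rev 2: infinite-syzygy saturation (res-L1-w44b-tri-1 AUDIT-o9 §4, «o9b′») -/

section InfiniteSyzygy

variable {T : Type u} [CommRing T]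

/-- **Infinite-syzygy saturation, levelled form** (tri-1's «o9b′», AUDIT-o9 §4): over a noetherian
`T`, if every `d`-th syzygy module `K` of every finitely generated module is an `m`-th syzygy of SOME
finitely generated module for EVERY `m` (e.g. periodic modules; on paper, MCM modules over a Gorenstein
ring), then `caⁿ(T) = caᵈ⁺¹(T)` for all `n ≥ d + 1` — the periodicity hypothesis of
`cohomologyAnnihilatorOfDegree_eq_of_isSyzygy_self` is used only through this property. [OURS] -/
theorem cohomologyAnnihilatorOfDegree_eq_of_isSyzygy_infinite [IsNoetherianRing T] (d : ℕ)
    (h : ∀ (M K : ModuleCat.{u} T), Module.Finite T M → IsSyzygy d M K →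
      ∀ m : ℕ, ∃ N : ModuleCat.{u} T, Module.Finite T N ∧ IsSyzygy m N K)
    {n : ℕ} (hn : d + 1 ≤ n) :
    cohomologyAnnihilatorOfDegree T n = cohomologyAnnihilatorOfDegree T (d + 1) := by
  refine le_antisymm ?_ (cohomologyAnnihilatorOfDegree_mono hn)
  obtain ⟨m, rfl⟩ : ∃ m, n = m + 1 := ⟨n - 1, by omega⟩
  intro x hx
  rw [mem_cohomologyAnnihilatorOfDegree_succ_iff_forall_isSyzygy]
  intro M K hM hK
  obtain ⟨N, hN, hmK⟩ := h M K hM hK m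
  haveI := hN
  exact (mem_cohomologyAnnihilatorOfDegree_succ_iff_forall_isSyzygy x).mp hx N K hN hmK

/-- **Infinite-syzygy saturation**: `ca(T) = caᵈ⁺¹(T)` under the same hypothesis. [OURS] -/
theorem cohomologyAnnihilator_eq_of_isSyzygy_infinite [IsNoetherianRing T] (d : ℕ)
    (h : ∀ (M K : ModuleCat.{u} T), Module.Finite T M → IsSyzygy d M K →
      ∀ m : ℕ, ∃ N : ModuleCat.{u} T, Module.Finite T N ∧ IsSyzygy m N K) :
    cohomologyAnnihilator T = cohomologyAnnihilatorOfDegree T (d + 1) := by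
  refine le_antisymm ?_ (cohomologyAnnihilatorOfDegree_le _)
  intro x hx
  obtain ⟨n, hn⟩ := mem_cohomologyAnnihilator_iff.mp hx
  have hx' : x ∈ cohomologyAnnihilatorOfDegree T (max n (d + 1)) :=
    cohomologyAnnihilatorOfDegree_mono (le_max_left _ _) hn
  rwa [cohomologyAnnihilatorOfDegree_eq_of_isSyzygy_infinite d h (le_max_right _ _)] at hx'

/-- Periodic modules are infinite syzygies: the hypothesis of `cohomologyAnnihilatorOfDegree_eq_of_isSyzygy_self`
implies that of `cohomologyAnnihilatorOfDegree_eq_of_isSyzygy_infinite`. [OURS] -/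
theorem isSyzygy_infinite_of_isSyzygy_self [IsNoetherianRing T] (d : ℕ)
    (hper : ∀ (M K : ModuleCat.{u} T), Module.Finite T M → IsSyzygy d M K →
      ∃ q : ℕ, 0 < q ∧ IsSyzygy q K K)
    (M K : ModuleCat.{u} T) (hM : Module.Finite T M) (hK : IsSyzygy d M K) (m : ℕ) :
    ∃ N : ModuleCat.{u} T, Module.Finite T N ∧ IsSyzygy m N K := by
  obtain ⟨q, hq, hKK⟩ := hper M K hM hK
  haveI := hM
  haveI : Module.Finite T K := finite_of_isSyzygy _ hM hK
  obtain ⟨q', rfl⟩ : ∃ q', q = q' + 1 := ⟨q - 1, by omega⟩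
  have hbig : IsSyzygy (m + q' * m) K K := by
    have := IsSyzygy.self_mul hKK m
    rw [show (q' + 1) * m = m + q' * m by ring] at this
    exact this
  obtain ⟨N, hN, hmK⟩ := exists_isSyzygy_split (q' * m) hbig
  exact ⟨N, finite_of_isSyzygy _ ‹Module.Finite T K› hN, hmK⟩

end InfiniteSyzygy

end Summit.ResolutionOfSingularities.ResolutionOfSingularities.Theorems.HomologicalConductor.PeriodicSaturation

end
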